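import Literature.RingTheory.FormalGroups.NilpotentEvaluation         -- ★ p844664: `evalNilp`, `evalNilp₂` (the lines' texts, verbatim)
import Literature.RingTheory.FormalGroups.NilpotentPointLaws           -- ★ p844794 (β) engine part 4: `evalNilp₂_zero_right`, `evalNilp_nsmulHom_succ`, `evalNilp₂_negSeries_right`
import Literature.RingTheory.FormalGroups.FormalGroupHomNeg            -- ★ `negHom`, `comp_neg` (homomorphisms commute with `ι`)
import Literature.AlgebraicGeometry.GroupSchemes.BarsottiTateGroupHom   -- ★ `BTGroup`, `BTGroup.Hom` (`app`, `id`, `comp`)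
import HarnessLib

/-!
# Nilpotent-points currency for Barsotti–Tate groups over an affine base: `B ≅ F[p^∞]` on nilpotent points
# ([Tate 1967] §2.2; [Messing 1972] Ch. II (3.3.18)) — the predicates of the P6d dictionary line, and their first API

Topic `Literature/AlgebraicGeometry/GroupSchemes`; namespace `Literature.AlgebraicGeometry.GroupSchemes`.  DEFINITIONS (two `abbrev`,
four `Prop`-valued `def`s) + fully proved theorems; no named fact, no instance, no notation, no `sorry`.  Cell `hodgecm-mathlib`, P6 «MOD
programme», sub-desk F0P6d, deal (E2) 13:57:08Z: the POINTS-CURRENCY PREDICATES of sub-line 2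
`Cruxes/HLiu418/Lines/F0_P6d_ConnectedBTDictionary.lean` (tree v1 c1e18024788a0261, :83–:130) reproduced VERBATIM — `TorsPts`, `specOver`,
`IsPTorsionOfLawVia`, `IsPTorsionOfOLawVia`, `IsRingActionBT`, `IsConnectedDimOne` — over ★ `NilpotentEvaluation.evalNilp ∕ evalNilp₂` (the
line's inline `evalNilp₂` is text-identical to ★ p844664's and is therefore dropped), so that (i) the desk's next edition re-points the letters
`ConnectedDimOneIsOModuleLaw` (HL-D) ∕ `KernelSubfunctorOfHeight` (HL-E) ∕ `OrdSSKernelsOnBT` to this module token-identically, and (ii) HL-D's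
CLOSER can be a `Literature/` ∕ `Theorems/` theorem over importable names (a closer cannot import a `Cruxes/…/Lines` module).  HC_CM is proved
only modulo the printed citations until rung 0 closes; nothing here is about HC.

THE PRINT.  [Tate1967] §2.2: a `p`-divisible group `G = (G_ν)` over a complete Noetherian local ring with residue characteristic `p`;
for `G` connected, `G_ν` is the kernel of `[p^ν]` on the formal Lie group `Γ` attached to `G` («`G_ν = Γ[p^ν]`», Prop. 1: `Γ ↦ Γ[p^∞]`
is an equivalence between divisible commutative formal Lie groups and connected `p`-divisible groups).  [Messing1972] Ch. II (3.3.18):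
the same over a base where `p` is nilpotent.  Here: the AFFINE, one-dimensional, functor-of-points form — a ★ `BTGroup (Spec A) p H`
`B` IS `F[p^∞]` for a commutative one-dimensional law `F` over `A` when there are bijections
`e n R : (Spec R → B.G n over Spec A) ≃ {x ∈ Nil(R) ∣ [pⁿ]_F(x) = 0}`, natural in the `A`-algebra `R`, carrying the group law `μ`
of `B.G n` to `F`-addition of nilpotent points and `incl n` to the inclusions (`IsPTorsionOfLawVia`); with an `𝒪`-action `β` on `B`
matched with `ρ : 𝒪 → End(F)` (`IsPTorsionOfOLawVia`); `IsRingActionBT` says `β` is a ring action; `IsConnectedDimOne` (over a field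
`k`) says `Γ(B.G n) ≃ₐ[k] k[X]⧸(X^{p^{nH}})`.

MAIN STATEMENTS.  §1 the six predicates (VERBATIM).  §2 API — `IsRingActionBT`: `map_one`, `map_mul`, `app_add`, `app_add'` (`β (a+b) =
β a * β b` in the group `End(B.G n)` of the group object, Mathlib `MonObj.Hom.group`), `app_one`, **`app_zero`** (`β 0` is the trivial
endomorphism), `app_neg`, **`app_natCast`** (`β m = [m] = (𝟙)^m`; so `β p = [p]`); `IsPTorsionOfLawVia`: `fst_mul` (`e (f * g) = F(e f, e g)`),
`fst_incl`, `naturality`, `zero_mem_torsPts`, **`fst_one`** (`e` carries the unit section to `0`), `negSeries_mem_torsPts` (`[pⁿ] ∘ ι = ι ∘ [pⁿ]`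
on points), **`fst_inv`** (`e (f⁻¹) = ι_F(e f)`, ★ `FormalGroupNeg.negSeries`), **`fst_comp_pow_id`** (`e (f ≫ [m]) = [m]_F (e f)`:
multiplication by `m` on `B` is ★ `nsmulHom F m` on points); `IsPTorsionOfOLawVia`: `law`, `fst_act`.

## References
* [Tate1967] J. T. Tate, *p-divisible groups*, Proc. Conf. Local Fields (Driebergen, 1966), Springer (1967) — §2.2, Prop. 1.
* [Messing1972] W. Messing, *The Crystals Associated to Barsotti–Tate Groups*, LNM 264 (1972) — Ch. II, (3.3.18).
-/

noncomputable section

universe u v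

open AlgebraicGeometry CategoryTheory MonObj CartesianMonoidalCategory
open Literature.RingTheory.FormalGroups (FormalGroupHom evalNilp evalNilp₂)

namespace Literature.AlgebraicGeometry.GroupSchemes

/-! ## §1 The predicates (VERBATIM the texts of `Cruxes/HLiu418/Lines/F0_P6d_ConnectedBTDictionary.lean` v1 :83–:130; `evalNilp`∕`evalNilp₂` = ★ `NilpotentEvaluation`) -/

section Points

variable {A : Type u} [CommRing A]

/-- `F[pⁿ](R) = {x ∈ Nil(R) | [pⁿ]_F(x) = 0}` — the `pⁿ`-torsion nilpotent points of the law `F` with values in the `A`-algebra `R`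
(`[m]_F` = ★ `FormalGroupHom.nsmulHom F m`, evaluation ★ `evalNilp`). [cite: Tate1967, §2.2] -/
abbrev TorsPts (F : FormalGroup A) [F.IsComm] (p n : ℕ) (R : Type u) [CommRing R] [Algebra A R] : Type u :=
  {x : R // IsNilpotent x ∧ evalNilp (FormalGroupHom.nsmulHom F (p ^ n)).toPowerSeries x = 0}

/-- `Spec R → Spec A` as an object over `Spec A`, for an `A`-algebra `R`. [cite: Tate1967, §2.2] -/
abbrev specOver (R : Type u) [CommRing R] [Algebra A R] : Over (Spec (.of A)) :=
  Over.mk (Spec.map (CommRingCat.ofHom (algebraMap A R)))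

/-- The comparison maps `e n R : (B.G n)(R) ≃ F[pⁿ](R)` IDENTIFY `B` WITH THE `p`-POWER TORSION OF THE LAW `F`: they carry `μ` to
`F`-addition of nilpotent points, `incl n` to the inclusions, and are natural in `R`. [cite: Tate1967, §2.2] [cite: Messing1972, Ch. II (3.3.18)] -/
def IsPTorsionOfLawVia (F : FormalGroup A) [F.IsComm] (p : ℕ) {H : ℕ} (B : BTGroup (Spec (.of A)) p H)
    (e : ∀ (n : ℕ) (R : Type u) [CommRing R] [Algebra A R], (specOver R ⟶ B.G n) ≃ TorsPts F p n R) : Prop :=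
  (∀ (n : ℕ) (R : Type u) [CommRing R] [Algebra A R] (f g : specOver R ⟶ B.G n),
      letI := B.grpObj n
      ((e n R) (lift f g ≫ μ[B.G n])).1 = evalNilp₂ F.toPowerSeries ((e n R) f).1 ((e n R) g).1) ∧
  (∀ (n : ℕ) (R : Type u) [CommRing R] [Algebra A R] (f : specOver R ⟶ B.G n),
      ((e (n + 1) R) (f ≫ B.incl n)).1 = ((e n R) f).1) ∧
  (∀ (n : ℕ) (R R' : Type u) [CommRing R] [Algebra A R] [CommRing R'] [Algebra A R'] (φ : R →ₐ[A] R')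
      (g : specOver R' ⟶ specOver R), g.left = Spec.map (CommRingCat.ofHom φ.toRingHom) →
      ∀ f : specOver R ⟶ B.G n, ((e n R') (g ≫ f)).1 = φ ((e n R) f).1)

/-- … AND MATCH ACTIONS: `β : 𝒪 → BTGroup.Hom B B` on the BT side corresponds to `ρ : 𝒪 → End(F)` on the law side —
`e (f ∘ βₐ) = [a]_F (e f)` on nilpotent points. [cite: Tate1967, §2.2] [cite: Messing1972, Ch. II (3.3.18)] -/
def IsPTorsionOfOLawVia (𝒪 : Type v) (F : FormalGroup A) [F.IsComm] (ρ : 𝒪 → FormalGroupHom F F) (p : ℕ) {H : ℕ}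
    (B : BTGroup (Spec (.of A)) p H) (β : 𝒪 → BTGroup.Hom B B)
    (e : ∀ (n : ℕ) (R : Type u) [CommRing R] [Algebra A R], (specOver R ⟶ B.G n) ≃ TorsPts F p n R) : Prop :=
  IsPTorsionOfLawVia F p B e ∧
    ∀ (a : 𝒪) (n : ℕ) (R : Type u) [CommRing R] [Algebra A R] (f : specOver R ⟶ B.G n),
      ((e n R) (f ≫ (β a).app n)).1 = evalNilp (ρ a).toPowerSeries ((e n R) f).1

/-- `β : 𝒪 → End(B)` IS A RING ACTION on the BT group: `β 1 = id`, `β (ab) = β a ∘ β b` (★ `Hom.comp` is diagrammatic), and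
`β (a + b) = β a + β b` layerwise, the sum of two endomorphisms of the group object `B.G n` being `μ ∘ (β a, β b)`.
[cite: Tate1967, §2.2] -/
def IsRingActionBT {𝒪 : Type v} [CommRing 𝒪] {p H : ℕ} (B : BTGroup (Spec (.of A)) p H) (β : 𝒪 → BTGroup.Hom B B) : Prop :=
  β 1 = BTGroup.Hom.id B ∧ (∀ a b : 𝒪, β (a * b) = (β b).comp (β a)) ∧
    ∀ (a b : 𝒪) (n : ℕ), letI := B.grpObj n; (β (a + b)).app n = lift ((β a).app n) ((β b).app n) ≫ μ[B.G n]

end Points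

/-- `B` over the field `k` IS CONNECTED OF DIMENSION ONE: every layer's coordinate ring is the one-generator truncated polynomial
algebra `Γ(B.G n) ≃ₐ[k] k[X]⧸(X^{p^{nH}})` (connected = one point; dimension one = one generator), the `k`-algebra structure being the
structure map's. [cite: Messing1972, Ch. II (3.3.18)] [cite: Tate1967, §2.2] -/
def IsConnectedDimOne {k : Type u} [Field k] {p H : ℕ} (B : BTGroup (Spec (.of k)) p H) : Prop :=
  ∀ n, letI : Algebra k Γ((B.G n).left, ⊤) := ((Scheme.ΓSpecIso (.of k)).inv ≫ (B.G n).hom.appTop).hom.toAlgebra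
    Nonempty (Γ((B.G n).left, ⊤) ≃ₐ[k] (Polynomial k ⧸ Ideal.span {(Polynomial.X : Polynomial k) ^ (p ^ (n * H))}))


/-! ## §2 API of the predicates -/

section API

variable {A : Type u} [CommRing A] {p H : ℕ} {B : BTGroup (Spec (.of A)) p H}

namespace IsRingActionBT

variable {𝒪 : Type v} [CommRing 𝒪] {β : 𝒪 → BTGroup.Hom B B}

/-- `β 1 = id`. [cite: Tate1967, §2.2] -/
theorem map_one (h : IsRingActionBT B β) : β 1 = BTGroup.Hom.id B := h.1

/-- `β (ab) = β a ∘ β b` (diagrammatic `comp`). [cite: Tate1967, §2.2] -/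
theorem map_mul (h : IsRingActionBT B β) (a b : 𝒪) : β (a * b) = (β b).comp (β a) := h.2.1 a b

/-- `β (a + b) = μ ∘ (β a, β b)` layerwise. [cite: Tate1967, §2.2] -/
theorem app_add (h : IsRingActionBT B β) (a b : 𝒪) (n : ℕ) :
    letI := B.grpObj n; (β (a + b)).app n = lift ((β a).app n) ((β b).app n) ≫ μ[B.G n] := h.2.2 a b n

/-- `β (a + b) = β a * β b` in the group `Hom(B.G n, B.G n)` of the group object `B.G n`. [cite: Tate1967, §2.2] -/
theorem app_add' (h : IsRingActionBT B β) (a b : 𝒪) (n : ℕ) :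
    letI := B.grpObj n; (β (a + b)).app n = (β a).app n * (β b).app n := by
  letI := B.grpObj n
  exact h.2.2 a b n

/-- `(β 1).app n = 𝟙`. [cite: Tate1967, §2.2] -/
theorem app_one (h : IsRingActionBT B β) (n : ℕ) : (β 1).app n = 𝟙 (B.G n) := by
  rw [h.map_one, BTGroup.Hom.id_app]

/-- **`β 0` is the trivial endomorphism** (the unit `toUnit ≫ η` of the group `Hom(B.G n, B.G n)`): `β 0 = β 0 * β 0`.
[cite: Tate1967, §2.2] -/
theorem app_zero (h : IsRingActionBT B β) (n : ℕ) : letI := B.grpObj n; (β 0).app n = 1 := by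
  letI := B.grpObj n
  have h0 := h.app_add' 0 0 n
  rw [add_zero] at h0
  exact (mul_eq_left.mp h0.symm)

/-- `β (−a) = (β a)⁻¹` layerwise. [cite: Tate1967, §2.2] -/
theorem app_neg (h : IsRingActionBT B β) (a : 𝒪) (n : ℕ) : letI := B.grpObj n; (β (-a)).app n = ((β a).app n)⁻¹ := by
  letI := B.grpObj n
  have h0 := h.app_add' a (-a) n
  rw [add_neg_cancel, h.app_zero] at h0
  exact (eq_inv_of_mul_eq_one_right h0.symm)

/-- **`β m = [m]`**: the action of a natural number is the `m`-th power of the identity in `End(B.G n)` (multiplication by `m`);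
in particular `β p = [p]`. [cite: Tate1967, §2.2] -/
theorem app_natCast (h : IsRingActionBT B β) (m : ℕ) (n : ℕ) : letI := B.grpObj n; (β m).app n = (𝟙 (B.G n)) ^ m := by
  letI := B.grpObj n
  induction m with
  | zero => rw [Nat.cast_zero, pow_zero]; exact h.app_zero n
  | succ m ih => rw [Nat.cast_succ, h.app_add', ih, h.app_one, pow_succ]

end IsRingActionBT

namespace IsPTorsionOfLawVia

variable {F : FormalGroup A} [F.IsComm]
  {e : ∀ (n : ℕ) (R : Type u) [CommRing R] [Algebra A R], (specOver R ⟶ B.G n) ≃ TorsPts F p n R}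

/-- `e (f * g) = F(e f, e g)` (product in the group `Hom(Spec R, B.G n)`). [cite: Tate1967, §2.2] -/
theorem fst_mul (h : IsPTorsionOfLawVia F p B e) (n : ℕ) (R : Type u) [CommRing R] [Algebra A R] (f g : specOver R ⟶ B.G n) :
    letI := B.grpObj n; ((e n R) (f * g)).1 = evalNilp₂ F.toPowerSeries ((e n R) f).1 ((e n R) g).1 := by
  letI := B.grpObj n
  exact h.1 n R f g

/-- `e (f ≫ incl) = e f`. [cite: Tate1967, §2.2] -/
theorem fst_incl (h : IsPTorsionOfLawVia F p B e) (n : ℕ) (R : Type u) [CommRing R] [Algebra A R] (f : specOver R ⟶ B.G n) :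
    ((e (n + 1) R) (f ≫ B.incl n)).1 = ((e n R) f).1 := h.2.1 n R f

/-- Naturality of `e` in the `A`-algebra `R`. [cite: Tate1967, §2.2] -/
theorem naturality (h : IsPTorsionOfLawVia F p B e) (n : ℕ) (R R' : Type u) [CommRing R] [Algebra A R] [CommRing R'] [Algebra A R']
    (φ : R →ₐ[A] R') (g : specOver R' ⟶ specOver R) (hg : g.left = Spec.map (CommRingCat.ofHom φ.toRingHom))
    (f : specOver R ⟶ B.G n) : ((e n R') (g ≫ f)).1 = φ ((e n R) f).1 := h.2.2 n R R' φ g hg f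

/-- `f(0) = f₀` for evaluation at the nilpotent element `0`. [folklore] -/
private theorem evalNilp_at_zero {R : Type u} [CommRing R] [Algebra A R] (f : PowerSeries A) :
    evalNilp f (0 : R) = algebraMap A R (PowerSeries.constantCoeff f) := by
  rw [Literature.RingTheory.FormalGroups.evalNilp_eq_sum f (N := 1) (by rw [pow_one]), Finset.sum_range_one, pow_zero, _root_.mul_one,
    PowerSeries.coeff_zero_eq_constantCoeff]

/-- `0 ∈ F[pⁿ](R)`. [cite: Tate1967, §2.2] -/
theorem zero_mem_torsPts (n : ℕ) (R : Type u) [CommRing R] [Algebra A R] :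
    IsNilpotent (0 : R) ∧ evalNilp (FormalGroupHom.nsmulHom F (p ^ n)).toPowerSeries (0 : R) = 0 :=
  ⟨IsNilpotent.zero, by rw [evalNilp_at_zero, (FormalGroupHom.nsmulHom F (p ^ n)).constantCoeff_eq_zero, map_zero]⟩

/-- **`e` carries the unit section to `0`**: the unit `1 = toUnit ≫ η` of `Hom(Spec R, B.G n)` has coordinate `0` (the point `z` with
`e z = 0` satisfies `z * z = z` since `F(0,0) = 0`). [cite: Tate1967, §2.2] -/
theorem fst_one (h : IsPTorsionOfLawVia F p B e) (n : ℕ) (R : Type u) [CommRing R] [Algebra A R] :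
    letI := B.grpObj n; ((e n R) 1).1 = 0 := by
  letI := B.grpObj n
  set z : specOver R ⟶ B.G n := (e n R).symm ⟨0, zero_mem_torsPts n R⟩ with hz
  have hz0 : ((e n R) z).1 = 0 := by rw [hz, Equiv.apply_symm_apply]
  have hzz : z * z = z := by
    apply (e n R).injective
    apply Subtype.ext
    rw [h.fst_mul, hz0, Literature.RingTheory.FormalGroups.evalNilp₂_zero_right F IsNilpotent.zero]
  have hz1 : z = 1 := mul_eq_left.mp hzz
  rw [← hz1, hz0]

/-- `ι_F(x) ∈ F[pⁿ](R)` when `x ∈ F[pⁿ](R)`: `[pⁿ] ∘ ι = ι ∘ [pⁿ]`. [cite: Tate1967, §2.2] -/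
theorem negSeries_mem_torsPts (n : ℕ) (R : Type u) [CommRing R] [Algebra A R] (x : TorsPts F p n R) :
    IsNilpotent (evalNilp (Literature.RingTheory.FormalGroups.FormalGroupNeg.negSeries F) x.1) ∧
      evalNilp (FormalGroupHom.nsmulHom F (p ^ n)).toPowerSeries
        (evalNilp (Literature.RingTheory.FormalGroups.FormalGroupNeg.negSeries F) x.1) = 0 := by
  refine ⟨Literature.RingTheory.FormalGroups.isNilpotent_evalNilp
    (Literature.RingTheory.FormalGroups.FormalGroupNeg.constantCoeff_negSeries F) _, ?_⟩
  -- `[pⁿ](ι x) = ([pⁿ] ∘ ι)(x) = (ι ∘ [pⁿ])(x) = ι([pⁿ] x) = ι(0) = 0`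
  have hcomm : (FormalGroupHom.nsmulHom F (p ^ n)).comp (FormalGroupHom.negHom F) =
      (FormalGroupHom.negHom F).comp (FormalGroupHom.nsmulHom F (p ^ n)) := by
    have h := FormalGroupHom.comp_neg (FormalGroupHom.nsmulHom F (p ^ n)) (FormalGroupHom.id F)
    rw [FormalGroupHom.comp_id] at h
    rw [FormalGroupHom.neg, FormalGroupHom.neg, FormalGroupHom.comp_id] at h
    exact h
  have h1 := Literature.RingTheory.FormalGroups.evalNilp_comp (FormalGroupHom.nsmulHom F (p ^ n)) (FormalGroupHom.negHom F)
    (R := R) x.2.1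
  rw [hcomm, Literature.RingTheory.FormalGroups.evalNilp_comp _ _ x.2.1, x.2.2, FormalGroupHom.negHom_toPowerSeries,
    evalNilp_at_zero, Literature.RingTheory.FormalGroups.FormalGroupNeg.constantCoeff_negSeries, map_zero] at h1
  rw [← FormalGroupHom.negHom_toPowerSeries]
  exact h1.symm

/-- **`e` carries inverses to `ι_F`-points**: `e (f⁻¹) = ι_F(e f)` (the point with coordinate `ι_F(e f)` is a right inverse of `f`
since `F(x, ι x) = 0 = e 1`). [cite: Tate1967, §2.2] -/
theorem fst_inv (h : IsPTorsionOfLawVia F p B e) (n : ℕ) (R : Type u) [CommRing R] [Algebra A R] (f : specOver R ⟶ B.G n) :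
    letI := B.grpObj n;
    ((e n R) f⁻¹).1 = evalNilp (Literature.RingTheory.FormalGroups.FormalGroupNeg.negSeries F) ((e n R) f).1 := by
  letI := B.grpObj n
  set g : specOver R ⟶ B.G n := (e n R).symm ⟨_, negSeries_mem_torsPts n R ((e n R) f)⟩ with hg
  have hg1 : ((e n R) g).1 = evalNilp (Literature.RingTheory.FormalGroups.FormalGroupNeg.negSeries F) ((e n R) f).1 := by
    rw [hg, Equiv.apply_symm_apply]
  have hfg : f * g = 1 := by
    apply (e n R).injective
    apply Subtype.ext
    rw [h.fst_mul, hg1, Literature.RingTheory.FormalGroups.evalNilp₂_negSeries_right F ((e n R) f).2.1, h.fst_one]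
  rw [← hg1, ← eq_inv_of_mul_eq_one_right hfg]

/-- **Multiplication by `m` on `B` is `[m]_F` on points**: `e (f ≫ [m]) = [m]_F (e f)` (`[m] = (𝟙)^m` in `End(B.G n)`,
`[m]_F` = ★ `nsmulHom`). [cite: Tate1967, §2.2] -/
theorem fst_comp_pow_id (h : IsPTorsionOfLawVia F p B e) (n : ℕ) (R : Type u) [CommRing R] [Algebra A R]
    (f : specOver R ⟶ B.G n) (m : ℕ) :
    letI := B.grpObj n;
    ((e n R) (f ≫ (𝟙 (B.G n)) ^ m)).1 = evalNilp (FormalGroupHom.nsmulHom F m).toPowerSeries ((e n R) f).1 := by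
  letI := B.grpObj n
  induction m with
  | zero =>
    have h1 : f ≫ (1 : B.G n ⟶ B.G n) = 1 := by
      change f ≫ (toUnit _ ≫ η[B.G n]) = toUnit _ ≫ η[B.G n]
      rw [← Category.assoc, comp_toUnit]
    rw [pow_zero, h1, h.fst_one, Literature.RingTheory.FormalGroups.FormalGroupHom.evalNilp_nsmulHom_zero]
  | succ m ih =>
    have hm : f ≫ ((𝟙 (B.G n)) ^ m * 𝟙 (B.G n)) = (f ≫ (𝟙 (B.G n)) ^ m) * f := by
      change f ≫ (lift _ _ ≫ μ[B.G n]) = lift _ _ ≫ μ[B.G n]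
      rw [← Category.assoc, comp_lift, Category.comp_id]
    rw [pow_succ, hm, h.fst_mul, ih, Literature.RingTheory.FormalGroups.FormalGroupHom.evalNilp_nsmulHom_succ m ((e n R) f).2.1]

end IsPTorsionOfLawVia

namespace IsPTorsionOfOLawVia

variable {𝒪 : Type v} {F : FormalGroup A} [F.IsComm] {ρ : 𝒪 → FormalGroupHom F F} {β : 𝒪 → BTGroup.Hom B B}
  {e : ∀ (n : ℕ) (R : Type u) [CommRing R] [Algebra A R], (specOver R ⟶ B.G n) ≃ TorsPts F p n R}

/-- The law part. [cite: Tate1967, §2.2] -/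
theorem law (h : IsPTorsionOfOLawVia 𝒪 F ρ p B β e) : IsPTorsionOfLawVia F p B e := h.1

/-- The action part: `e (f ≫ βₐ) = [a]_F (e f)`. [cite: Tate1967, §2.2] -/
theorem fst_act (h : IsPTorsionOfOLawVia 𝒪 F ρ p B β e) (a : 𝒪) (n : ℕ) (R : Type u) [CommRing R] [Algebra A R]
    (f : specOver R ⟶ B.G n) : ((e n R) (f ≫ (β a).app n)).1 = evalNilp (ρ a).toPowerSeries ((e n R) f).1 := h.2 a n R f

end IsPTorsionOfOLawVia

end API

end Literature.AlgebraicGeometry.GroupSchemes
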